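import Literature.Probability.LatticeModels.POAlgebraFKG
import HarnessLib

/-!
# Richards (2004), §2: the induction step (2.5)–(2.13) of the printed proof of Theorem 1.1, verbatim,
# and its exact status

CITATION HEADER.  Source: D. St. P. Richards, *Algebraic methods toward higher-order probability inequalities, II*,
Ann. Probab. **32** (2004) 1509–1544 [Richards2004], pp. 1514–1517, read from the materialised Project Euclid copy
(`paper:url-a35428b45c2b`, p0006–p0009).  Secondary: E. H. Lieb, S. Sahi, J. Math. Phys. 63 (2022) [LiebSahi2021] p. 3
("we regard [Richards' Theorems 1.1/1.3] as incomplete"); S. Sahi, Combinatorica 28 (2008) [Sahi2008] p. 213.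

Richards' Theorem 1.1 asserts (1.7) `κ′₃(f₁,f₂,f₃) = 2E(f₁f₂f₃) − [E(f₁f₂)E(f₃) + E(f₁f₃)E(f₂) + E(f₁)E(f₂f₃)] +
E(f₁)E(f₂)E(f₃) ≥ 0` for nonnegative increasing `f_i` on a finite distributive lattice with an MTP₂ probability measure —
i.e. Sahi's `E₃ ≥ 0` (the tree's `SahiPositive μ 3`, `ConjugateCumulants.lean: forall_conjCumulant_nonneg_iff_sahiPositive`),
which is OPEN (`C₃`).  The printed proof (pp. 1514–1517, verbatim):

> "Let us first assume that `µ(a) > 0` for all `a ⊆ A`. Choose and fix `B`, an arbitrarily chosen subset of `A`. For any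
> `a ⊆ B`, define `µ_B(a) := Σ_{b ⊆ A∖B} µ(a ∪ b)` (2.2) and, for any function `f : 2^A → ℝ`, define
> `f_B(a) := µ_B(a)⁻¹ Σ_{b ⊆ A∖B} µ(a ∪ b) f(a ∪ b)` (2.3). … For any function `g : 2^B → ℝ`, we define
> `E_B(g) := Σ_{a ⊆ B} µ_B(a) g(a)`. … `E(f) = … = E_B(f_B)` (2.4). … To establish (1.7) it suffices, as observed by
> den Hollander and Keane (1986) in the case of the FKG inequality, to assume that `B = A ∖ {z}`, where `z ∈ A` is
> chosen arbitrarily; this amounts to a proof by induction on the length of maximal chains in the lattice `2^A`.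
> Using the shorthand notation `f_{iB}` to denote `(f_i)_B`, `i = 1, 2, 3`, we claim that
> `2E_B((f₁f₂f₃)_B) − [E_B((f₁f₂)_B f_{3B}) + E_B((f₁f₃)_B f_{2B}) + E_B(f_{1B}(f₂f₃)_B)] + E_B(f_{1B}f_{2B}f_{3B}) ≥ 0.` (2.5)
> By (2.2) and (2.3) we have `µ_B(a) = µ(a) + µ(a ∪ {z})` (2.6) and `f_B(a) = µ_B(a)⁻¹(µ(a)f(a) + µ(a ∪ {z})f(a ∪ {z}))`
> (2.7) for `a ⊆ B`. … Collecting together (2.8)–(2.10) … we obtain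
> `µ_B(a)³{2(f₁f₂f₃)_B(a) − [(f₁f₂)_B(a)f_{3B}(a) + (f₁f₃)_B(a)f_{2B}(a) + f_{1B}(a)(f₂f₃)_B(a)] + f_{1B}(a)f_{2B}(a)f_{3B}(a)}`
> ` = µ(a)µ(a ∪ {z}) × [(f₁(a ∪ {z}) − f₁(a)) Φ_{11B}(a) + f₁(a ∪ {z}) Φ_{12B}(a)]`, (2.11) where
> `Φ_{11B}(a) = µ(a)(f₂(a∪{z})f₃(a∪{z}) − f₂(a)f₃(a)) + µ(a∪{z})f₃(a)(f₂(a∪{z}) − f₂(a)) + µ(a∪{z})f₂(a)(f₃(a∪{z}) − f₃(a))`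
> (2.12) and `Φ_{12B}(a) = (µ(a ∪ {z}) + µ(a))(f₂(a ∪ {z}) − f₂(a))(f₃(a ∪ {z}) − f₃(a))` (2.13). Since each `f_i` is
> nonnegative and increasing, it follows that (2.12) and (2.13) are sums of products of nonnegative terms; hence (2.11) is
> nonnegative.  Next we divide both sides of (2.11) by `µ_B(a)²` and sum over all `a ⊆ B`. … Collecting these identities
> together and applying the nonnegativity of (2.11), we obtain (2.5).  Since `B` was chosen arbitrarily, we may set
> `B = ∅` in (2.5). By (2.2) and (2.3) we have `E_∅(f_{i∅}) ≡ E(f_i)`, `E_∅((f_if_j)_∅ f_{k∅}) ≡ E(f_if_j)E(f_k)`, … and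
> also `E_∅(f_{1∅}f_{2∅}f_{3∅}) ≡ E(f₁)E(f₂)E(f₃)`. Then (2.5) reduces to (1.7)."

What is here (everything PROVED; no named fact; `B` is indexed by its complement `C = A ∖ B` as in
`POAlgebraFKG.lean`, whose `POAlgebra.marg μ C` = `µ_B` (2.2) and `POAlgebra.cexp μ f C` = `f_B` (2.3) are used; `A = univ`
of a `Fintype ι`, the lattice is `Finset ι`):
* `Richards2004.display25 μ f₁ f₂ f₃ C` — the left-hand side of (2.5), verbatim (`E_B` = `ex (marg μ C)`).
* `Richards2004.condLaw μ C a` — the conditional law `ν_a(b) = µ(a ∪ b)/µ_B(a)` on `2^{A∖B}` (so that `f_B(a) = E_{ν_a} f(a ∪ ·)`,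
  `cexp_eq_ex_condLaw`); it is an FKG probability weight when `μ` is (`isFKGMeasure_condLaw`).
* **`Richards2004.display25_eq_sum_sahiE`** — the EXACT STATUS of (2.5): for every `B`,
  `(2.5)(B) = Σ_{a ⊆ B} µ_B(a) · E₃^{ν_a}(f₁(a ∪ ·), f₂(a ∪ ·), f₃(a ∪ ·))`, an average of instances of Sahi's `E₃` under
  the conditional laws on the cube `2^{A∖B}` (the integrand of (2.5) at `a` is literally `E₃` under `ν_a`).
* The PRINTED STEP, proved as printed: `Richards2004.identity_2_11` ((2.11) with (2.12)–(2.13), a polynomial identity, `ring`;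
  checked beforehand on 60 exact random points), hence **`Richards2004.display25_nonneg_singleton`** — (2.5) holds for
  `B = A ∖ {z}`, every `z`, every nonnegative weight and all nonnegative increasing `f_i` (there `ν_a` lives on the two-point
  chain `{a, a ∪ {z}}`).
* `Richards2004.display25_univ` — "(2.5) at `B = ∅` reduces to (1.7)": `display25 μ f univ = E₃^μ(f₁,f₂,f₃)` for a
  probability weight; and `Richards2004.display25_empty` — at `B = A` the display is identically `0`.
* **`Richards2004.display25_nonneg_of_sahiPositive`** / **`forall_display25_nonneg_iff`** — (2.5) at `B` follows from
  `E₃ ≥ 0` for the conditional laws `ν_a`, and "(2.5) for every `B`, every FKG weight and all nonnegative increasing `f`"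
  is EQUIVALENT to `C₃` on `2^A` (`∀` FKG probability weights `ν` on `Finset ι`, `SahiPositive ν 3`).
Reading (ours, stated once, here and in the docstrings — nothing is asserted about `C₃`): the computation (2.6)–(2.11)
is the case `|A ∖ B| = 1` of (2.5); nothing printed passes from `|A ∖ B| = k` to `k + 1`, because (2.5) is not a statement
about the pair `(µ_B, f_B)` alone (`(f_if_j)_B ≠ f_{iB} f_{jB}`), so the one-point step does not iterate; and (2.5) at
`B = ∅` is (1.7) itself.  Hence "Since `B` was chosen arbitrarily, we may set `B = ∅`" is exactly the unproved step,
consistent with [LiebSahi2021, p. 3] and [Gladkov2024, Rem. 8.8]; and no counterexample to (2.5) exists short of a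
counterexample to `C₃` (`forall_display25_nonneg_iff`).
-- TODO(general form): Richards works on an arbitrary finite distributive lattice `L` ("Without loss of generality, we
-- assume that L = 2^A"); here `L = 2^A` as in the printed proof.  Theorem 1.3 ((1.8), (1.9): fourth and fifth order)
-- has the same structure and is not transcribed.

## References
* D. St. P. Richards, Ann. Probab. 32 (2004) 1509–1544, §2, (2.2)–(2.13), pp. 1514–1517. [Richards2004]
* E. H. Lieb, S. Sahi, *On the extension of the FKG inequality to n functions*, J. Math. Phys. 63 (2022) 043301, p. 3.
  [LiebSahi2021]
* N. Gladkov, *Percolation inequalities and decision trees*, arXiv:2408.08457 (2024), Rem. 8.8. [Gladkov2024]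
-/

noncomputable section

namespace Literature.Combinatorics.Sahi2008

namespace Richards2004

open Finset Literature.Probability.LatticeModels.POAlgebra

variable {ι : Type*} [Fintype ι] [DecidableEq ι]

/-! ### The display (2.5) and the conditional laws -/

/-- **The left-hand side of Richards' (2.5)** at `B = A ∖ C`:
`2E_B((f₁f₂f₃)_B) − [E_B((f₁f₂)_B f_{3B}) + E_B((f₁f₃)_B f_{2B}) + E_B(f_{1B}(f₂f₃)_B)] + E_B(f_{1B}f_{2B}f_{3B})`, with
`E_B(g) = Σ_{a ⊆ B} µ_B(a) g(a)` (= `ex (marg μ C) g`, the marginal vanishing off `2^B`), `µ_B = marg μ C` (2.2) and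
`f_B = cexp μ f C` (2.3). [cite: Richards2004, (2.5) (p. 1515)] -/
def display25 (μ : Finset ι → ℝ) (f₁ f₂ f₃ : Finset ι → ℝ) (C : Finset ι) : ℝ :=
  2 * ex (marg μ C) (cexp μ (f₁ * f₂ * f₃) C) -
      (ex (marg μ C) (cexp μ (f₁ * f₂) C * cexp μ f₃ C) + ex (marg μ C) (cexp μ (f₁ * f₃) C * cexp μ f₂ C) +
        ex (marg μ C) (cexp μ f₁ C * cexp μ (f₂ * f₃) C)) +
    ex (marg μ C) (cexp μ f₁ C * cexp μ f₂ C * cexp μ f₃ C)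

/-- **The conditional law `ν_a` on `2^{A∖B}` given `a ⊆ B`**: `ν_a(b) = µ(a ∪ b)/µ_B(a)` for `b ⊆ C = A ∖ B` (and `0`
off `2^C`), so that `f_B(a) = Σ_b ν_a(b) f(a ∪ b)` ("`f_B(a)` is the conditional expectation of `f`, given `a ⊆ B`").
[cite: Richards2004, (2.3) (p. 1514–1515)] -/
def condLaw (μ : Finset ι → ℝ) (C a : Finset ι) : Finset ι → ℝ := fun b =>
  if b ⊆ C then μ (a ∪ b) / marg μ C a else 0

omit [Fintype ι] in
/-- `µ_B(a) ≠ 0` forces `a ⊆ B`. [cite: Richards2004, (2.2) (p. 1514)] -/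
theorem disjoint_of_marg_ne_zero {μ : Finset ι → ℝ} {C a : Finset ι} (h : marg μ C a ≠ 0) : Disjoint a C := by
  by_contra hd
  exact h (marg_of_not_disjoint hd)

/-- `f_B(a) = E_{ν_a}(f(a ∪ ·))` wherever `µ_B(a) ≠ 0`. [cite: Richards2004, (2.3) (p. 1514–1515)] -/
theorem cexp_eq_ex_condLaw {μ : Finset ι → ℝ} (f : Finset ι → ℝ) {C a : Finset ι} (h : marg μ C a ≠ 0) :
    cexp μ f C a = ex (condLaw μ C a) (fun b => f (a ∪ b)) := by
  unfold cexp ex condLaw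
  rw [if_neg h, smul_eq_mul, mul_sum]
  have hfilter : (univ.filter fun b : Finset ι => b ⊆ C) = C.powerset := by
    ext b; simp
  rw [← sum_filter_add_sum_filter_not univ (fun b : Finset ι => b ⊆ C), hfilter]
  rw [sum_eq_zero (s := univ.filter fun b : Finset ι => ¬b ⊆ C) (fun b hb => by
    rw [mem_filter] at hb; rw [if_neg hb.2, zero_mul]), add_zero]
  refine sum_congr rfl fun b hb => ?_
  rw [mem_powerset] at hb
  rw [if_pos hb, smul_eq_mul]
  ring

/-- The integrand of (2.5) at `a` IS Sahi's `E₃` under the conditional law `ν_a`, weighted by `µ_B(a)`: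
`µ_B(a)·{2(f₁f₂f₃)_B(a) − [(f₁f₂)_B(a)f_{3B}(a) + …] + f_{1B}(a)f_{2B}(a)f_{3B}(a)} = µ_B(a)·E₃^{ν_a}(f₁(a∪·), f₂(a∪·), f₃(a∪·))`.
[cite: Richards2004, (2.5) and (2.11) (p. 1515–1516)] -/
theorem marg_mul_integrand_eq (μ : Finset ι → ℝ) (f₁ f₂ f₃ : Finset ι → ℝ) (C a : Finset ι) :
    marg μ C a * (2 * cexp μ (f₁ * f₂ * f₃) C a -
        (cexp μ (f₁ * f₂) C a * cexp μ f₃ C a + cexp μ (f₁ * f₃) C a * cexp μ f₂ C a +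
          cexp μ f₁ C a * cexp μ (f₂ * f₃) C a) + cexp μ f₁ C a * cexp μ f₂ C a * cexp μ f₃ C a) =
      marg μ C a * sahiE (condLaw μ C a) 3
        ![fun b => f₁ (a ∪ b), fun b => f₂ (a ∪ b), fun b => f₃ (a ∪ b)] := by
  by_cases h : marg μ C a = 0
  · rw [h, zero_mul, zero_mul]
  · rw [sahiE_three, cexp_eq_ex_condLaw _ h, cexp_eq_ex_condLaw _ h, cexp_eq_ex_condLaw _ h,
      cexp_eq_ex_condLaw _ h, cexp_eq_ex_condLaw _ h, cexp_eq_ex_condLaw _ h, cexp_eq_ex_condLaw _ h]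
    simp only [Pi.mul_apply]
    have e1 : (fun b => f₁ (a ∪ b) * f₂ (a ∪ b) * f₃ (a ∪ b)) =
        (fun b => f₁ (a ∪ b)) * (fun b => f₂ (a ∪ b)) * fun b => f₃ (a ∪ b) := rfl
    have e2 : (fun b => f₁ (a ∪ b) * f₂ (a ∪ b)) = (fun b => f₁ (a ∪ b)) * fun b => f₂ (a ∪ b) := rfl
    have e3 : (fun b => f₁ (a ∪ b) * f₃ (a ∪ b)) = (fun b => f₁ (a ∪ b)) * fun b => f₃ (a ∪ b) := rfl
    have e4 : (fun b => f₂ (a ∪ b) * f₃ (a ∪ b)) = (fun b => f₂ (a ∪ b)) * fun b => f₃ (a ∪ b) := rfl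
    rw [e1, e2, e3, e4]
    ring

/-- **THE EXACT STATUS OF (2.5).**  For every `B = A ∖ C`, every weight `μ` and all `f₁, f₂, f₃`:
`(2.5)(B) = Σ_a µ_B(a) · E₃^{ν_a}(f₁(a ∪ ·), f₂(a ∪ ·), f₃(a ∪ ·))` — the display (2.5) is an average, over `a ⊆ B` with
the marginal weights, of instances of Sahi's `E₃` under the conditional laws on the cube `2^{A∖B}`.  (So (2.5) at `B` is a
family of `C₃`-instances on `2^{|A∖B|}`; the printed computation (2.6)–(2.11) is `|A ∖ B| = 1`, and at `B = ∅` the display is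
(1.7) = `C₃` itself, `display25_univ`.)  [cite: Richards2004, (2.5) (p. 1515); LiebSahi2021, p. 3] -/
theorem display25_eq_sum_sahiE (μ : Finset ι → ℝ) (f₁ f₂ f₃ : Finset ι → ℝ) (C : Finset ι) :
    display25 μ f₁ f₂ f₃ C =
      ∑ a, marg μ C a * sahiE (condLaw μ C a) 3 ![fun b => f₁ (a ∪ b), fun b => f₂ (a ∪ b), fun b => f₃ (a ∪ b)] := by
  rw [← sum_congr rfl fun a _ => marg_mul_integrand_eq μ f₁ f₂ f₃ C a]
  unfold display25 ex
  simp only [mul_sum, ← sum_add_distrib, ← sum_sub_distrib, Pi.mul_apply]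
  exact sum_congr rfl fun a _ => by ring

/-! ### The printed step: (2.6)–(2.13) ⇒ (2.5) for `B = A ∖ {z}` -/

/-- **Richards' identity (2.11) with (2.12)–(2.13), verbatim** (multiplied out: `m₀ = µ(a)`, `m₁ = µ(a ∪ {z})`,
`µ_B(a) = m₀ + m₁` by (2.6), `x_i = f_i(a)`, `y_i = f_i(a ∪ {z})`, and by (2.7)–(2.10)
`µ_B(a)(f_if_jf_k)_B(a) = m₀x_ix_jx_k + m₁y_iy_jy_k`, `µ_B(a)(f_if_j)_B(a) = m₀x_ix_j + m₁y_iy_j`, `µ_B(a)f_{iB}(a) = m₀x_i + m₁y_i`):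
`µ_B³{…} = m₀m₁[(y₁ − x₁)Φ₁₁ + y₁Φ₁₂]` with `Φ₁₁ = m₀(y₂y₃ − x₂x₃) + m₁x₃(y₂ − x₂) + m₁x₂(y₃ − x₃)` and
`Φ₁₂ = (m₁ + m₀)(y₂ − x₂)(y₃ − x₃)`.  A polynomial identity (`ring`).
[cite: Richards2004, (2.6)–(2.13) (pp. 1515–1516)] -/
theorem identity_2_11 (m₀ m₁ x₁ x₂ x₃ y₁ y₂ y₃ : ℝ) :
    (m₀ + m₁) ^ 2 * (2 * (m₀ * (x₁ * x₂ * x₃) + m₁ * (y₁ * y₂ * y₃))) -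
        (m₀ + m₁) * ((m₀ * (x₁ * x₂) + m₁ * (y₁ * y₂)) * (m₀ * x₃ + m₁ * y₃) +
          (m₀ * (x₁ * x₃) + m₁ * (y₁ * y₃)) * (m₀ * x₂ + m₁ * y₂) +
          (m₀ * x₁ + m₁ * y₁) * (m₀ * (x₂ * x₃) + m₁ * (y₂ * y₃))) +
        (m₀ * x₁ + m₁ * y₁) * (m₀ * x₂ + m₁ * y₂) * (m₀ * x₃ + m₁ * y₃) =
      m₀ * m₁ * ((y₁ - x₁) * (m₀ * (y₂ * y₃ - x₂ * x₃) + m₁ * x₃ * (y₂ - x₂) + m₁ * x₂ * (y₃ - x₃)) +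
        y₁ * ((m₁ + m₀) * (y₂ - x₂) * (y₃ - x₃))) := by
  ring

/-- "(2.12) and (2.13) are sums of products of nonnegative terms; hence (2.11) is nonnegative": for
`0 ≤ m₀, m₁` and `0 ≤ x_i ≤ y_i`, the right-hand side of (2.11) is `≥ 0`. [cite: Richards2004, p. 1516] -/
theorem rhs_2_11_nonneg {m₀ m₁ x₁ x₂ x₃ y₁ y₂ y₃ : ℝ} (hm₀ : 0 ≤ m₀) (hm₁ : 0 ≤ m₁) (hx₁ : 0 ≤ x₁) (hx₂ : 0 ≤ x₂)
    (hx₃ : 0 ≤ x₃) (h₁ : x₁ ≤ y₁) (h₂ : x₂ ≤ y₂) (h₃ : x₃ ≤ y₃) :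
    0 ≤ m₀ * m₁ * ((y₁ - x₁) * (m₀ * (y₂ * y₃ - x₂ * x₃) + m₁ * x₃ * (y₂ - x₂) + m₁ * x₂ * (y₃ - x₃)) +
        y₁ * ((m₁ + m₀) * (y₂ - x₂) * (y₃ - x₃))) := by
  have hy₁ : 0 ≤ y₁ := hx₁.trans h₁
  have h23 : x₂ * x₃ ≤ y₂ * y₃ := mul_le_mul h₂ h₃ hx₃ (hx₂.trans h₂)
  have hΦ₁ : 0 ≤ m₀ * (y₂ * y₃ - x₂ * x₃) + m₁ * x₃ * (y₂ - x₂) + m₁ * x₂ * (y₃ - x₃) := by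
    have t1 : 0 ≤ m₀ * (y₂ * y₃ - x₂ * x₃) := mul_nonneg hm₀ (by linarith)
    have t2 : 0 ≤ m₁ * x₃ * (y₂ - x₂) := mul_nonneg (mul_nonneg hm₁ hx₃) (by linarith)
    have t3 : 0 ≤ m₁ * x₂ * (y₃ - x₃) := mul_nonneg (mul_nonneg hm₁ hx₂) (by linarith)
    linarith
  have hΦ₂ : 0 ≤ (m₁ + m₀) * (y₂ - x₂) * (y₃ - x₃) :=
    mul_nonneg (mul_nonneg (by linarith) (by linarith)) (by linarith)
  exact mul_nonneg (mul_nonneg hm₀ hm₁)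
    (add_nonneg (mul_nonneg (by linarith) hΦ₁) (mul_nonneg hy₁ hΦ₂))

omit [Fintype ι] in
/-- (2.6): `µ_{A∖{z}}(a) = µ(a) + µ(a ∪ {z})` for `z ∉ a` (and `0` for `z ∈ a`, off `2^B`).
[cite: Richards2004, (2.6) (p. 1515)] -/
theorem marg_singleton (μ : Finset ι → ℝ) (z : ι) (a : Finset ι) :
    marg μ {z} a = if z ∈ a then 0 else μ a + μ (a ∪ {z}) := by
  have hp : ({z} : Finset ι).powerset = {∅, {z}} := by
    ext b; simp [Finset.subset_singleton_iff]
  split_ifs with hz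
  · exact marg_of_not_disjoint (by simpa using hz)
  · rw [marg_of_disjoint (by simpa using hz), hp, sum_pair (by simp), union_empty]

/-- Expectation under the two-point conditional law `ν_a` on `{a, a ∪ {z}}` ((2.7) multiplied by `µ_B(a)`):
`µ_B(a)·E_{ν_a}(g(a ∪ ·)) = µ(a)g(a) + µ(a ∪ {z})g(a ∪ {z})` for `z ∉ a`, `µ_B(a) ≠ 0`.
[cite: Richards2004, (2.7) (p. 1515)] -/
theorem marg_mul_ex_condLaw_singleton {μ : Finset ι → ℝ} {z : ι} {a : Finset ι}
    (h : marg μ {z} a ≠ 0) (g : Finset ι → ℝ) :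
    marg μ {z} a * ex (condLaw μ {z} a) (fun b => g (a ∪ b)) = μ a * g a + μ (a ∪ {z}) * g (a ∪ {z}) := by
  unfold ex condLaw
  rw [mul_sum]
  have hfilter : (univ.filter fun b : Finset ι => b ⊆ {z}) = ({∅, {z}} : Finset (Finset ι)) := by
    ext b; simp [Finset.subset_singleton_iff]
  rw [← sum_filter_add_sum_filter_not univ (fun b : Finset ι => b ⊆ {z}), hfilter,
    sum_eq_zero (s := univ.filter fun b : Finset ι => ¬b ⊆ {z}) (fun b hb => by
      rw [mem_filter] at hb; rw [if_neg hb.2, zero_mul, mul_zero]), add_zero,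
    sum_pair (by simp)]
  simp only [empty_subset, if_true, Finset.Subset.refl, union_empty]
  field_simp

/-- **Richards' printed step: (2.5) holds for `B = A ∖ {z}`**, for every `z`, every nonnegative weight `μ` and all
nonnegative increasing `f₁, f₂, f₃` — by (2.6)–(2.13): the integrand of (2.5) at `a` times `µ_B(a)³` is the right-hand
side of (2.11), a sum of products of nonnegative terms.  (This is the case `|A ∖ B| = 1`; here the conditional laws
`ν_a` live on the two-point chains `{a, a ∪ {z}}`.) [cite: Richards2004, (2.5)–(2.13) (pp. 1515–1516)] -/
theorem display25_nonneg_singleton {μ : Finset ι → ℝ} (hμ0 : ∀ α, 0 ≤ μ α) {f₁ f₂ f₃ : Finset ι → ℝ}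
    (h₁ : ∀ x, 0 ≤ f₁ x) (h₂ : ∀ x, 0 ≤ f₂ x) (h₃ : ∀ x, 0 ≤ f₃ x) (hm₁ : Monotone f₁) (hm₂ : Monotone f₂)
    (hm₃ : Monotone f₃) (z : ι) : 0 ≤ display25 μ f₁ f₂ f₃ {z} := by
  rw [display25_eq_sum_sahiE]
  refine sum_nonneg fun a _ => ?_
  by_cases h : marg μ {z} a = 0
  · rw [h, zero_mul]
  have hz : z ∉ a := by
    intro hz; rw [marg_singleton, if_pos hz] at h; exact h rfl
  -- (2.6)
  have h26 : marg μ {z} a = μ a + μ (a ∪ {z}) := by rw [marg_singleton, if_neg hz]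
  have hB : μ a + μ (a ∪ {z}) ≠ 0 := h26 ▸ h
  have hB3 : 0 < (μ a + μ (a ∪ {z})) ^ 3 :=
    pow_pos (lt_of_le_of_ne (add_nonneg (hμ0 _) (hμ0 _)) (Ne.symm hB)) 3
  refine mul_nonneg (marg_nonneg hμ0 _ _) ?_
  -- (2.7): the moments under `ν_a`
  have E' : ∀ g : Finset ι → ℝ, ex (condLaw μ {z} a) (fun b => g (a ∪ b)) =
      (μ a * g a + μ (a ∪ {z}) * g (a ∪ {z})) / (μ a + μ (a ∪ {z})) := fun g => by
    rw [eq_div_iff hB, mul_comm, ← h26]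
    exact marg_mul_ex_condLaw_singleton h g
  have E123 := E' (f₁ * f₂ * f₃)
  have E12 := E' (f₁ * f₂)
  have E13 := E' (f₁ * f₃)
  have E23 := E' (f₂ * f₃)
  simp only [Pi.mul_apply] at E123 E12 E13 E23
  rw [sahiE_three]
  simp only [Pi.mul_def]
  rw [E123, E12, E13, E23, E' f₁, E' f₂, E' f₃, ← mul_nonneg_iff_of_pos_left hB3]
  -- (2.8)–(2.13): clear denominators and use (2.11)
  have hsub : a ⊆ a ∪ {z} := subset_union_left
  refine (rhs_2_11_nonneg (hμ0 a) (hμ0 (a ∪ {z})) (h₁ a) (h₂ a) (h₃ a) (hm₁ hsub) (hm₂ hsub)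
    (hm₃ hsub)).trans_eq ?_
  rw [← identity_2_11]
  field_simp
  ring

/-! ### (2.5) at the two ends: `B = ∅` is (1.7), `B = A` is trivial -/

/-- The marginal on `2^∅`: `µ_∅(∅) = Σ_b µ(b)` and `µ_∅(a) = 0` for `a ≠ ∅`. [cite: Richards2004, (2.2) (p. 1514), p. 1517] -/
theorem marg_univ (μ : Finset ι → ℝ) (a : Finset ι) : marg μ univ a = if a = ∅ then ∑ b, μ b else 0 := by
  split_ifs with ha
  · subst ha
    rw [marg_of_disjoint (disjoint_empty_left _), powerset_univ]
    exact sum_congr rfl fun b _ => by rw [empty_union]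
  · refine marg_of_not_disjoint fun hd => ha ?_
    have := disjoint_iff_inter_eq_empty.1 hd
    rwa [inter_univ] at this

/-- The conditional law given nothing is `μ` itself (probability weight). [cite: Richards2004, p. 1517] -/
theorem condLaw_univ_empty {μ : Finset ι → ℝ} (hμ1 : ∑ b, μ b = 1) : condLaw μ univ ∅ = μ := by
  funext b
  simp [condLaw, marg_univ, hμ1]

/-- **"we may set `B = ∅` in (2.5) … Then (2.5) reduces to (1.7)"**: for a probability weight, the display at `B = ∅`
(`C = A`) is Sahi's `E₃(f₁,f₂,f₃)` = Richards' `κ′₃` itself. [cite: Richards2004, p. 1517; Sahi2008, p. 213] -/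
theorem display25_univ {μ : Finset ι → ℝ} (hμ1 : ∑ b, μ b = 1) (f₁ f₂ f₃ : Finset ι → ℝ) :
    display25 μ f₁ f₂ f₃ univ = sahiE μ 3 ![f₁, f₂, f₃] := by
  rw [display25_eq_sum_sahiE, Fintype.sum_eq_single ∅ (fun a ha => by rw [marg_univ, if_neg ha, zero_mul]),
    marg_univ, if_pos rfl, hμ1, one_mul, condLaw_univ_empty hμ1]
  simp only [empty_union]

/-- At the other end `B = A` (`C = ∅`) the display is identically `0` (`f_A = f`, so it reads
`2E(f₁f₂f₃) − 3E(f₁f₂f₃) + E(f₁f₂f₃)`): (2.5) carries no information at the top and all of (1.7) at the bottom.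
[cite: Richards2004, (2.2)–(2.5) (pp. 1514–1515)] -/
theorem display25_empty (μ : Finset ι → ℝ) (f₁ f₂ f₃ : Finset ι → ℝ) : display25 μ f₁ f₂ f₃ ∅ = 0 := by
  unfold display25 ex
  simp only [marg_empty, mul_sum, ← sum_add_distrib, ← sum_sub_distrib]
  refine sum_eq_zero fun a _ => ?_
  by_cases h : μ a = 0
  · rw [h]; ring
  · simp only [cexp_empty_of_ne _ h, Pi.mul_apply]; ring

/-! ### (2.5) for every `B` ⟺ `C₃` -/

omit [Fintype ι] in
/-- `ν_a ≥ 0` for `μ ≥ 0`. [cite: Richards2004, (2.3) (p. 1514–1515)] -/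
theorem condLaw_nonneg {μ : Finset ι → ℝ} (hμ0 : ∀ α, 0 ≤ μ α) (C a b : Finset ι) : 0 ≤ condLaw μ C a b := by
  unfold condLaw
  split_ifs
  · exact div_nonneg (hμ0 _) (marg_nonneg hμ0 _ _)
  · exact le_rfl

/-- `ν_a` has total mass `1` where `µ_B(a) ≠ 0`. [cite: Richards2004, (2.3) (p. 1514–1515)] -/
theorem sum_condLaw {μ : Finset ι → ℝ} {C a : Finset ι} (h : marg μ C a ≠ 0) : ∑ b, condLaw μ C a b = 1 := by
  have h1 := cexp_eq_ex_condLaw (μ := μ) (fun _ => (1 : ℝ)) h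
  unfold cexp at h1
  rw [if_neg h] at h1
  simp only [smul_eq_mul, mul_one] at h1
  rw [← marg_of_disjoint (disjoint_of_marg_ne_zero h), inv_mul_cancel₀ h] at h1
  rw [ex] at h1
  simpa using h1.symm

/-- **`ν_a` is an FKG probability weight when `μ` is** ("`µ_B` is MTP₂" has the companion: the conditional laws on
`2^{A∖B}` inherit (2.1), `µ(a∪b)µ(a∪b′) ≤ µ(a∪(b∩b′))µ(a∪(b∪b′))`). [cite: Richards2004, (2.1)–(2.3) (p. 1514–1515)] -/
theorem isFKGMeasure_condLaw {μ : Finset ι → ℝ} (hμ : IsFKGMeasure μ) {C a : Finset ι} (h : marg μ C a ≠ 0) :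
    IsFKGMeasure (condLaw μ C a) where
  nonneg := condLaw_nonneg hμ.nonneg C a
  sum_eq_one := sum_condLaw h
  mul_le_mul := by
    intro b b'
    have hm : 0 < marg μ C a := lt_of_le_of_ne (marg_nonneg hμ.nonneg _ _) (Ne.symm h)
    by_cases hb : b ⊆ C
    · by_cases hb' : b' ⊆ C
      · have hi : b ⊓ b' ⊆ C := inter_subset_left.trans hb
        have hs : b ⊔ b' ⊆ C := union_subset hb hb'
        simp only [condLaw, if_pos hb, if_pos hb', if_pos hi, if_pos hs]
        rw [div_mul_div_comm, div_mul_div_comm]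
        refine div_le_div_of_nonneg_right ?_ (mul_pos hm hm).le
        have key := hμ.mul_le_mul (a ∪ b) (a ∪ b')
        have e1 : (a ∪ b) ⊓ (a ∪ b') = a ∪ b ⊓ b' := by
          ext x; simp only [inf_eq_inter, mem_inter, mem_union]; tauto
        have e2 : (a ∪ b) ⊔ (a ∪ b') = a ∪ (b ⊔ b') := by
          ext x; simp only [sup_eq_union, mem_union]; tauto
        rwa [e1, e2] at key
      · simp only [condLaw, if_neg hb', mul_zero]
        exact mul_nonneg (condLaw_nonneg hμ.nonneg _ _ _) (condLaw_nonneg hμ.nonneg _ _ _)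
    · simp only [condLaw, if_neg hb, zero_mul]
      exact mul_nonneg (condLaw_nonneg hμ.nonneg _ _ _) (condLaw_nonneg hμ.nonneg _ _ _)

omit [Fintype ι] [DecidableEq ι] in
/-- `b ↦ f(a ∪ b)` is increasing when `f` is ("`f_B` is increasing if `f` is increasing" has this pointwise companion).
[cite: Richards2004, p. 1515] -/
theorem monotone_comp_union [DecidableEq ι] {f : Finset ι → ℝ} (hf : Monotone f) (a : Finset ι) :
    Monotone fun b => f (a ∪ b) :=
  fun _ _ hbb' => hf (union_subset_union (Subset.refl a) hbb')

/-- **(2.5) at `B` follows from `E₃ ≥ 0` under the conditional laws `ν_a`, `a ⊆ B`** (for nonnegative increasing `f_i`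
and `μ ≥ 0`) — by `display25_eq_sum_sahiE`. [cite: Richards2004, (2.5) (p. 1515); LiebSahi2021, p. 3] -/
theorem display25_nonneg_of_sahiPositive {μ : Finset ι → ℝ} (hμ0 : ∀ α, 0 ≤ μ α) {C : Finset ι}
    (hpos : ∀ a, marg μ C a ≠ 0 → SahiPositive (condLaw μ C a) 3) {f₁ f₂ f₃ : Finset ι → ℝ}
    (h₁ : ∀ x, 0 ≤ f₁ x) (h₂ : ∀ x, 0 ≤ f₂ x) (h₃ : ∀ x, 0 ≤ f₃ x) (hm₁ : Monotone f₁) (hm₂ : Monotone f₂)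
    (hm₃ : Monotone f₃) : 0 ≤ display25 μ f₁ f₂ f₃ C := by
  rw [display25_eq_sum_sahiE]
  refine sum_nonneg fun a _ => ?_
  by_cases h : marg μ C a = 0
  · rw [h, zero_mul]
  refine mul_nonneg (marg_nonneg hμ0 _ _) (hpos a h _ ?_ ?_)
  · intro i x
    fin_cases i
    · exact h₁ _
    · exact h₂ _
    · exact h₃ _
  · intro i
    fin_cases i
    · exact monotone_comp_union hm₁ a
    · exact monotone_comp_union hm₂ a
    · exact monotone_comp_union hm₃ a

/-- **(2.5) for every `B`, given `C₃` on `2^A`**: if every FKG probability weight on `2^A` is Sahi-positive of order `3`,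
then Richards' display (2.5) is nonnegative for every `B`, every FKG probability weight and all nonnegative increasing
`f₁, f₂, f₃` (each conditional law `ν_a` is FKG). [cite: Richards2004, (2.5) (p. 1515); LiebSahi2021, p. 3] -/
theorem display25_nonneg_of_forall_sahiPositive
    (hC3 : ∀ ν : Finset ι → ℝ, IsFKGMeasure ν → SahiPositive ν 3) {μ : Finset ι → ℝ} (hμ : IsFKGMeasure μ)
    {f₁ f₂ f₃ : Finset ι → ℝ} (h₁ : ∀ x, 0 ≤ f₁ x) (h₂ : ∀ x, 0 ≤ f₂ x) (h₃ : ∀ x, 0 ≤ f₃ x) (hm₁ : Monotone f₁)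
    (hm₂ : Monotone f₂) (hm₃ : Monotone f₃) (C : Finset ι) : 0 ≤ display25 μ f₁ f₂ f₃ C :=
  display25_nonneg_of_sahiPositive hμ.nonneg (fun _ ha => hC3 _ (isFKGMeasure_condLaw hμ ha)) h₁ h₂ h₃ hm₁ hm₂ hm₃

/-- **"(2.5) for every `B`" is EQUIVALENT to `C₃` on `2^A`.**  On the lattice `2^A = Finset ι`: Richards' display (2.5) is
nonnegative for every `B`, every FKG probability weight and all nonnegative increasing `f₁, f₂, f₃` if and only if every
FKG probability weight on `2^A` is Sahi-positive of order `3` (`⇐`: the conditional laws are FKG; `⇒`: `B = ∅` is (1.7)).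
So the sentence "Since `B` was chosen arbitrarily, we may set `B = ∅` in (2.5)" (p. 1517), after (2.5) has been proved for
`B = A ∖ {z}` only (`display25_nonneg_singleton`), is exactly the open conjecture `C₃`; nothing is asserted about it here.
[cite: Richards2004, (2.5) (p. 1515) and p. 1517; LiebSahi2021, p. 3; Sahi2008, Conj. 5 (p. 212)] -/
theorem forall_display25_nonneg_iff :
    (∀ (μ : Finset ι → ℝ), IsFKGMeasure μ → ∀ (f₁ f₂ f₃ : Finset ι → ℝ), (∀ x, 0 ≤ f₁ x) → (∀ x, 0 ≤ f₂ x) →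
        (∀ x, 0 ≤ f₃ x) → Monotone f₁ → Monotone f₂ → Monotone f₃ → ∀ C, 0 ≤ display25 μ f₁ f₂ f₃ C) ↔
      ∀ ν : Finset ι → ℝ, IsFKGMeasure ν → SahiPositive ν 3 := by
  constructor
  · intro h ν hν f hf hfm
    have h3 := h ν hν (f 0) (f 1) (f 2) (hf 0) (hf 1) (hf 2) (hfm 0) (hfm 1) (hfm 2) univ
    rw [display25_univ hν.sum_eq_one] at h3
    have ef : ![f 0, f 1, f 2] = f := by
      funext i; fin_cases i <;> rfl
    rwa [ef] at h3
  · intro hC3 μ hμ f₁ f₂ f₃ h₁ h₂ h₃ hm₁ hm₂ hm₃ C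
    exact display25_nonneg_of_forall_sahiPositive hC3 hμ h₁ h₂ h₃ hm₁ hm₂ hm₃ C

end Richards2004

end Literature.Combinatorics.Sahi2008
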